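import Mathlib
import HarnessLib

/-!
# Crux `Steer` (stmt-ResolutionOfSingularities-16345) — K-TX part 4, the END ARGUMENT of case B in derivation form: in characteristic `2`
# an element `D₀·(S²·c·m − Γ²)` with `D₀, S, c ∉ 𝔭`, `∂c = 0` and `∂m ∉ 𝔭` for some derivation `∂` never lies in `𝔭²`

[cite: CossartPiltant2008, §4 (the first-order / Jacobian test on the exceptional chart)]; folklore commutative algebra.

This file isolates the purely algebraic contradiction at the end of the case-B argument of the toric unit exit (see
`…Theorems.FrobeniusClosingSteerToricUnitExitFresh` for the one-variable polynomial version `sq_free_polynomial` used for FRESH units).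
The multivariate/derivation form below is the one the STALE-unit case needs (design: seat folder `D/res-D-brk-2/HANDOFF.md`, gen 6,
"RECOMMENDED ROUTE for K-TX part 4d"): the survivor unit letter `u` is sent by a residue-compatible ring map `Φ` to a Laurent monomial `m` of a
polynomial ring over the residue field, the radicand `u·W − h²` (after clearing denominators `D₀`, `S`) to `D₀·(S²·w̄·m − Γ²)`, membership in
the square of the centre to membership in `𝔭²`, and the partial derivative `∂ = ∂/∂Y_v` in a variable `Y_v` occurring in `m` with ODD exponent
has `∂m ∉ 𝔭` — contradiction by `sq_free_of_derivation`.

Contents (namespace `…Theorems.SteerToricUnitExit`):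
* `derivation_mem_of_mem_sq` — a derivation maps `𝔭²` into `𝔭`;
* `derivation_sq_eq_zero` — `∂(a²) = 0` in characteristic `2`;
* `sq_free_of_derivation` — the end argument;
* `pderiv_X_pow_odd_mul`, `X_pow_mul_not_mem` — the `MvPolynomial` instance: `∂/∂Y_v (Y_v^(2k+1)·q) = Y_v^(2k)·q ∉ 𝔭` when `Y_v, q ∉ 𝔭`
  and `∂q/∂Y_v = 0`;
* `sq_free_mvPolynomial` — the packaged multivariate statement.
-/

-- single-problem summit: the doubled namespace component `ResolutionOfSingularities` is forced
set_option linter.dupNamespace false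

open scoped BigOperators

noncomputable section

namespace Summit.ResolutionOfSingularities.ResolutionOfSingularities.Theorems.SteerToricUnitExit

section Derivation

variable {R₀ A : Type*} [CommRing R₀] [CommRing A] [Algebra R₀ A]

/-- A derivation maps the square of an ideal into the ideal: `∂(ab) = a∂b + b∂a`. [folklore] -/
theorem derivation_mem_of_mem_sq (D : Derivation R₀ A A) (𝔭 : Ideal A) {x : A} (hx : x ∈ 𝔭 ^ 2) : D x ∈ 𝔭 := by
  rw [pow_two] at hx
  refine Submodule.mul_induction_on hx (fun a ha b hb => ?_) (fun a b ha hb => ?_)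
  · rw [Derivation.leibniz, smul_eq_mul, smul_eq_mul]
    exact 𝔭.add_mem (𝔭.mul_mem_right _ ha) (𝔭.mul_mem_right _ hb)
  · rw [map_add]; exact 𝔭.add_mem ha hb

/-- In characteristic `2` every derivation kills squares. [folklore] -/
theorem derivation_sq_eq_zero (h2 : (2 : A) = 0) (D : Derivation R₀ A A) (a : A) : D (a ^ 2) = 0 := by
  rw [pow_two, Derivation.leibniz, smul_eq_mul, ← two_mul, h2, zero_mul]

/-- **The end argument of case B (derivation form).** In a commutative ring of characteristic `2` with a derivation `∂` and a prime
ideal `𝔭`: if `D₀, S, c ∉ 𝔭`, `∂c = 0` and `∂m ∉ 𝔭`, then `D₀·(S²·(c·m) − Γ²) ∉ 𝔭²`.  Indeed `∂(𝔭²) ⊆ 𝔭`, the element lies in `𝔭`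
so `S²cm − Γ² ∈ 𝔭`, and `∂` of it is `S²·c·∂m` (the squares die), which is not in `𝔭`.
[cite: CossartPiltant2008, §4]; folklore. -/
theorem sq_free_of_derivation (h2 : (2 : A) = 0) (D : Derivation R₀ A A) (𝔭 : Ideal A) [h𝔭 : 𝔭.IsPrime]
    (D₀ S Γ c m : A) (hD₀ : D₀ ∉ 𝔭) (hS : S ∉ 𝔭) (hc : c ∉ 𝔭) (hDc : D c = 0) (hm : D m ∉ 𝔭) :
    D₀ * (S ^ 2 * (c * m) - Γ ^ 2) ∉ 𝔭 ^ 2 := by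
  intro hx
  set E := S ^ 2 * (c * m) - Γ ^ 2 with hE
  -- `E ∈ 𝔭`
  have hE𝔭 : E ∈ 𝔭 :=
    (h𝔭.mem_or_mem (Ideal.pow_le_self two_ne_zero hx)).resolve_left hD₀
  -- `∂(D₀ E) ∈ 𝔭`, hence `D₀ ∂E ∈ 𝔭`, hence `∂E ∈ 𝔭`
  have h1 : D (D₀ * E) ∈ 𝔭 := derivation_mem_of_mem_sq D 𝔭 hx
  rw [Derivation.leibniz, smul_eq_mul, smul_eq_mul] at h1
  have h2' : D₀ * D E ∈ 𝔭 := by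
    have := 𝔭.sub_mem h1 (𝔭.mul_mem_right (D D₀) hE𝔭)
    simpa using this
  have hDE : D E ∈ 𝔭 := (h𝔭.mem_or_mem h2').resolve_left hD₀
  -- compute `∂E = S² c ∂m`
  have hcomp : D E = S ^ 2 * c * D m := by
    rw [hE, map_sub, derivation_sq_eq_zero h2 D Γ, sub_zero, Derivation.leibniz, smul_eq_mul, smul_eq_mul,
      derivation_sq_eq_zero h2 D S, mul_zero, add_zero, Derivation.leibniz, smul_eq_mul, smul_eq_mul, hDc, mul_zero,
      add_zero]
    ring
  rw [hcomp] at hDE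
  rcases h𝔭.mem_or_mem hDE with h | h
  · rcases h𝔭.mem_or_mem h with h' | h'
    · exact hS (h𝔭.mem_of_pow_mem 2 h')
    · exact hc h'
  · exact hm h

end Derivation

section MvPoly

open MvPolynomial

variable {σ κ : Type*} [Field κ]

/-- `∂/∂Y_v (Y_v^(2k+1)·q) = Y_v^(2k)·q` in characteristic `2` when `∂q/∂Y_v = 0`. [folklore] -/
theorem pderiv_X_pow_odd_mul (h2 : (2 : κ) = 0) (v : σ) (k : ℕ) (q : MvPolynomial σ κ) (hq : pderiv v q = 0) :
    pderiv v (X v ^ (2 * k + 1) * q) = X v ^ (2 * k) * q := by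
  have h2' : (2 : MvPolynomial σ κ) = 0 := by rw [← map_ofNat (C : κ →+* MvPolynomial σ κ) 2, h2, map_zero]
  rw [Derivation.leibniz, hq, smul_zero, zero_add, smul_eq_mul, Derivation.leibniz_pow, pderiv_X_self, smul_eq_mul,
    mul_one, Nat.add_sub_cancel, nsmul_eq_mul, Nat.cast_succ, Nat.cast_mul, Nat.cast_two, h2', zero_mul, zero_add, one_mul]
  ring

/-- If `Y_v ∉ 𝔭` and `q ∉ 𝔭` (a prime ideal) then `Y_v^(2k)·q ∉ 𝔭`. [folklore] -/
theorem X_pow_mul_not_mem (𝔭 : Ideal (MvPolynomial σ κ)) [h𝔭 : 𝔭.IsPrime] (v : σ) (k : ℕ) (q : MvPolynomial σ κ)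
    (hv : (X v : MvPolynomial σ κ) ∉ 𝔭) (hq : q ∉ 𝔭) : X v ^ (2 * k) * q ∉ 𝔭 := fun h =>
  (h𝔭.mem_or_mem h).elim (fun h' => hv (h𝔭.mem_of_pow_mem _ h')) hq

/-- **The end argument of case B, multivariate polynomial form.** Over a field `κ` of characteristic `2`, for a prime ideal `𝔭` of
`κ[Y_σ]`, a variable `Y_v ∉ 𝔭`, `q ∉ 𝔭` with `∂q/∂Y_v = 0` (a monomial in the other variables, say), `D₀, S ∉ 𝔭` and a non-zero
constant `w`: `D₀·(S²·(w·(Y_v^(2k+1) q)) − Γ²) ∉ 𝔭²`. [cite: CossartPiltant2008, §4]; folklore. -/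
theorem sq_free_mvPolynomial (h2 : (2 : κ) = 0) (𝔭 : Ideal (MvPolynomial σ κ)) [𝔭.IsPrime] (v : σ) (k : ℕ)
    (q D₀ S Γ : MvPolynomial σ κ) (w : κ) (hw : w ≠ 0) (hv : (X v : MvPolynomial σ κ) ∉ 𝔭) (hq : q ∉ 𝔭)
    (hqv : pderiv v q = 0) (hD₀ : D₀ ∉ 𝔭) (hS : S ∉ 𝔭) :
    D₀ * (S ^ 2 * (C w * (X v ^ (2 * k + 1) * q)) - Γ ^ 2) ∉ 𝔭 ^ 2 := by
  have h2' : (2 : MvPolynomial σ κ) = 0 := by rw [← map_ofNat (C : κ →+* MvPolynomial σ κ) 2, h2, map_zero]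
  refine sq_free_of_derivation h2' (pderiv v) 𝔭 D₀ S Γ (C w) _ hD₀ hS ?_ (pderiv_C) ?_
  · -- a non-zero constant is a unit, hence not in the proper ideal `𝔭`
    exact fun h => Ideal.IsPrime.ne_top ‹_› (𝔭.eq_top_of_isUnit_mem h ((isUnit_iff_ne_zero.mpr hw).map C))
  · rw [pderiv_X_pow_odd_mul h2 v k q hqv]; exact X_pow_mul_not_mem 𝔭 v k q hv hq

end MvPoly

end Summit.ResolutionOfSingularities.ResolutionOfSingularities.Theorems.SteerToricUnitExit

end
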